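import Literature.NumberTheory.Rogawski1990.KottwitzSignArchTorus              -- ★ `kottwitzSignArchWeight_mk_archDiagTorus` (`e_∞ = ∏_w e_w`), `archStableOrbitalIntegral_classWeight_mul_archDiagTorus_eq_sum_of_conj`; brings ★ `ArchStableClassTorus`
import Literature.NumberTheory.Automorphic.ArchStableClassTorusFibreProduct   -- ★ FILE E p840833 (F0P3a-p05): `filter_univ_mk_archDiagTorus_comp_eq_piFinset` (the fibre of `ρ ↦ ⟦t(z∘ρ)⟧` is a box)
import HarnessLib

/-!
# Weighted class regrouping of a sum over all relabellings `ρ : W → S_N` at an ARBITRARY torus point of `G′_∞`, and the SIGNED stable sum when the per-place fibre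
# sums are proportional to the Kottwitz signs ((R1-h-d) (D2-comb); Rogawski 1990 §4.1 (4.1.1)–(4.1.2) pp. 39–40, §8.2 pp. 118, 122–124)

Topic `NumberTheory/Rogawski1990`; namespace `Literature.NumberTheory.Rogawski1990`.  THEOREMS ONLY (no `def`, no instance, no notation, no axiom, no named fact, no `sorry`);
pure finite book-keeping over ★ FILE E (F0P3a-p05) and ★ `KottwitzSignArchTorus`.  Cell `pub/hodgecm-mathlib`, ENGINE T1 (crux H413 = `stmt-HodgeConjecture-24833`); floor-2 road «(J-nc)
in-house», brick (D2-comb) of (R1-h-d) «signed regrouping» (LEAD F0P3a-plan (g9) WORD T8-119∕T8-120; F0P3-p03 (g9) «=» 07:08:40Z); author F0P3a-p07 (g8), 2026-09-01.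

THE POINT.  After (D0-3) and the per-`ρ` reading ((R1-h-c) ★ p842078 + ★ p842112), one side of the end state of the «method of §8.2» is
`Σ_{ρ : W → S₃} (∏_v w_v(ρ_v)) · Φ(⟦t(z⁰ ∘ ρ)⟧, a; m)` with per-place WEIGHTS `w_v(σ) = κ_v(σ)·λ_v(σ)` (jump coefficient × wall-measure scalar).  The term is a CLASS function of
`t(z⁰∘ρ)`; the fibres of `ρ ↦ ⟦t(z⁰∘ρ)⟧` are boxes `Π_v (fibre at v)` (★ FILE E), so the sum regroups over the DISTINCT classes `q` with coefficient `∏_v (Σ_{σ ∈ fibre_v} w_v σ)`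
(§1, any commutative semiring of weights, any torus point, any `N`).  If at every place the fibre sum is `Λ_v ·` (the matrix Kottwitz sign of the fibre's torus point) — the
ANALYTIC input of (R1-h-d): (b1) ★ p842004 + (b2′) ★ p842051 + uniqueness ★ p841778 make the noncompact constants of a class equal, (J-val) relates them to the compact-wall masses —
then the whole sum is `(∏_v Λ_v) · Σ_q e_∞(q) · Φ(q, a; m) = (∏_v Λ_v) · Φ^st_∞(t z⁰, (e_∞∘⟦·⟧)·a)` (§2, ★ `kottwitzSignArchWeight_mk_archDiagTorus` + ★
`archStableOrbitalIntegral_classWeight_mul_archDiagTorus_eq_sum_of_conj`) — the SIGNED stable orbital integral of the (ST-∞) conjunct.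
* §1 `sum_univ_prod_smul_eq_sum_image_sum_filter` (generic fibre regrouping of a product-weighted sum along any map), **`sum_filter_mk_archDiagTorus_comp_prod_eq_prod_sum_filter`**
  (the fibre sum of a product weight is the product of the per-place fibre sums), **`sum_univ_prod_smul_mk_archDiagTorus_comp_eq_sum_image`**.
* §2 **`sum_univ_prod_smul_mk_archDiagTorus_comp_eq_prod_smul_sum_image_kottwitzSignArchWeight`** (sign-proportional fibre sums ⇒ `(∏ Λ_v) •` the `e_∞`-weighted class sum) and
  **`sum_univ_prod_mul_classOrbitalIntegral_mk_archDiagTorus_comp_eq_prod_mul_archStableOrbitalIntegral`** (`= (∏_v Λ_v) · Φ^st_∞(t z, (e_∞∘⟦·⟧)·a)`, every family `m`, every `a`).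
HONEST LABEL: HC_CM is proved only modulo the 7 printed citations until rung 0 closes; this file is finite book-keeping and pays nothing by itself.

## References
* [Rogawski1990] J. D. Rogawski, *Automorphic Representations of Unitary Groups in Three Variables*, Ann. of Math. Stud. 123 (1990), §4.1 (4.1.1)–(4.1.2) pp. 39–40, §8.2 Prop. 8.2.1
  p. 118, pp. 122–124 («a non-zero constant times `Φ^st(γ₀, f)`»).
* [BorelJacquet1979] A. Borel, H. Jacquet, *Automorphic forms and automorphic representations*, PSPM 33.1 (1979), §4.1.
-/

set_option autoImplicit false

noncomputable section

open Matrix Equiv Finset NumberField NumberField.InfinitePlace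
open Literature.NumberTheory.Automorphic Literature.NumberTheory.Automorphic.UnitaryGroup
open scoped MatrixGroups ComplexConjugate

namespace Literature.NumberTheory.Rogawski1990

/-! ## §1 Weighted class regrouping -/

section Generic

/-- **Fibre regrouping of a product-weighted sum along a map** `F : (W → S) → Q`: `Σ_ρ c(ρ) • G(F ρ) = Σ_{q ∈ image F} (Σ_{ρ : F ρ = q} c ρ) • G q`
(Mathlib `sum_fiberwise_of_maps_to`, `sum_smul`). [cite: Rogawski1990, §4.1 (4.1.1) p. 39] -/
theorem sum_univ_smul_eq_sum_image_sum_filter {ι : Type*} [Fintype ι] {Q : Type*} [DecidableEq Q]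
    {R : Type*} [CommSemiring R] {M : Type*} [AddCommMonoid M] [Module R M]
    (F : ι → Q) (c : ι → R) (G : Q → M) :
    ∑ ρ, c ρ • G (F ρ) = ∑ q ∈ univ.image F, (∑ ρ ∈ univ.filter (fun ρ => F ρ = q), c ρ) • G q := by
  rw [← sum_fiberwise_of_maps_to (s := (univ : Finset ι)) (t := univ.image F) (g := F) fun ρ hρ => mem_image_of_mem F hρ]
  refine sum_congr rfl fun q _ => ?_
  rw [sum_smul]
  refine sum_congr rfl fun ρ hρ => ?_
  rw [(mem_filter.1 hρ).2]

end Generic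

section Torus

variable (L : Type) [Field L] [NumberField L] [IsCMField L] (N : ℕ) (α : Fin N → L)

open scoped Classical in
/-- **THE FIBRE SUM OF A PRODUCT WEIGHT IS THE PRODUCT OF THE PER-PLACE FIBRE SUMS**: the fibre of `ρ ↦ ⟦t(z∘ρ)⟧` through `r` is the box `Π_v {σ ∣ ⟦diag(z_v∘σ)⟧ = ⟦diag(z_v∘r_v)⟧}`
(★ FILE E `filter_univ_mk_archDiagTorus_comp_eq_piFinset`), so `Σ_{ρ ∈ fibre(r)} ∏_v w_v(ρ_v) = ∏_v Σ_{σ ∈ fibre_v(r_v)} w_v σ` (Mathlib `Finset.prod_univ_sum`).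
[cite: Rogawski1990, §4.1 (4.1.1) p. 39] [cite: BorelJacquet1979, §4.1] -/
theorem sum_filter_mk_archDiagTorus_comp_prod_eq_prod_sum_filter {R : Type*} [CommSemiring R]
    (z : {w : InfinitePlace L // IsComplex w} → Fin N → Circle) (wt : {w : InfinitePlace L // IsComplex w} → Perm (Fin N) → R)
    (r : {w : InfinitePlace L // IsComplex w} → Perm (Fin N)) :
    ∑ ρ ∈ univ.filter (fun ρ : {w : InfinitePlace L // IsComplex w} → Perm (Fin N) =>
        ConjClasses.mk (archDiagTorus L N α fun w => z w ∘ ρ w) = ConjClasses.mk (archDiagTorus L N α fun w => z w ∘ r w)),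
        ∏ v, wt v (ρ v) =
      ∏ v : {w : InfinitePlace L // IsComplex w}, ∑ σ ∈ univ.filter (fun σ : Perm (Fin N) =>
        ConjClasses.mk (⟨circleDiagonal N (z v ∘ σ), circleDiagonal_mem_archLocal_diagonal L N α v (z v ∘ σ)⟩ : archLocal L N (diagonal α) v) =
          ConjClasses.mk (⟨circleDiagonal N (z v ∘ r v), circleDiagonal_mem_archLocal_diagonal L N α v (z v ∘ r v)⟩ : archLocal L N (diagonal α) v)), wt v σ := by
  rw [filter_univ_mk_archDiagTorus_comp_eq_piFinset L N α z r, ← prod_univ_sum]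

open scoped Classical in
/-- **WEIGHTED CLASS REGROUPING AT AN ARBITRARY TORUS POINT**: `Σ_{ρ : W → S_N} (∏_v w_v(ρ_v)) • G(⟦t(z∘ρ)⟧) = Σ_{q} (Σ_{ρ ∈ fibre(q)} ∏_v w_v(ρ_v)) • G q` over the DISTINCT classes
`q ∈ univ.image (ρ ↦ ⟦t(z∘ρ)⟧)` (= the stable class of `t z`, ★ `conjClasses_stable_archDiagTorus_eq_range_of_conj`), for weights in any commutative semiring and `G` with values in any
module. [cite: Rogawski1990, §4.1 (4.1.1) p. 39; §8.2 Prop. 8.2.1 p. 118] -/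
theorem sum_univ_prod_smul_mk_archDiagTorus_comp_eq_sum_image {R : Type*} [CommSemiring R] {M : Type*} [AddCommMonoid M] [Module R M]
    (z : {w : InfinitePlace L // IsComplex w} → Fin N → Circle) (wt : {w : InfinitePlace L // IsComplex w} → Perm (Fin N) → R)
    (G : ConjClasses ↥(arch (↥(maximalRealSubfield L)) L (IsCMField.complexConj L) N (diagonal α)) → M) :
    ∑ ρ : {w : InfinitePlace L // IsComplex w} → Perm (Fin N), (∏ v, wt v (ρ v)) • G (ConjClasses.mk (archDiagTorus L N α fun w => z w ∘ ρ w)) =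
      ∑ q ∈ univ.image (fun ρ : {w : InfinitePlace L // IsComplex w} → Perm (Fin N) => ConjClasses.mk (archDiagTorus L N α fun w => z w ∘ ρ w)),
        (∑ ρ ∈ univ.filter (fun ρ : {w : InfinitePlace L // IsComplex w} → Perm (Fin N) =>
            ConjClasses.mk (archDiagTorus L N α fun w => z w ∘ ρ w) = q), ∏ v, wt v (ρ v)) • G q :=
  sum_univ_smul_eq_sum_image_sum_filter _ _ G

/-! ## §2 Sign-proportional fibre sums ⇒ the signed stable sum -/

open scoped Classical in
/-- **SIGN-PROPORTIONAL FIBRE SUMS GIVE THE `e_∞`-WEIGHTED CLASS SUM.**  If at every place `v` and every `r ∈ S_N` the fibre sum of the weight is `Λ_v` times the matrix Kottwitz sign of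
the fibre's torus point, `Σ_{σ : ⟦diag(z_v∘σ)⟧ = ⟦diag(z_v∘r)⟧} w_v σ = Λ_v · e(diag(z_v ∘ r))`, then
`Σ_{ρ} (∏_v w_v(ρ_v)) • G(⟦t(z∘ρ)⟧) = (∏_v Λ_v) • Σ_{q ∈ image} e_∞(q) • G q` (`e_∞(⟦t z′⟧) = ∏_v e(diag z′_v)`, ★ `kottwitzSignArchWeight_mk_archDiagTorus`).
[cite: Rogawski1990, §4.1 (4.1.2) pp. 39–40; §8.2 pp. 122–124] -/
theorem sum_univ_prod_smul_mk_archDiagTorus_comp_eq_prod_smul_sum_image_kottwitzSignArchWeight {M : Type*} [AddCommMonoid M] [Module ℂ M]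
    (z : {w : InfinitePlace L // IsComplex w} → Fin N → Circle) (wt : {w : InfinitePlace L // IsComplex w} → Perm (Fin N) → ℂ)
    (Λ : {w : InfinitePlace L // IsComplex w} → ℂ)
    (hΛ : ∀ (v : {w : InfinitePlace L // IsComplex w}) (r : Perm (Fin N)),
      ∑ σ ∈ univ.filter (fun σ : Perm (Fin N) =>
        ConjClasses.mk (⟨circleDiagonal N (z v ∘ σ), circleDiagonal_mem_archLocal_diagonal L N α v (z v ∘ σ)⟩ : archLocal L N (diagonal α) v) =
          ConjClasses.mk (⟨circleDiagonal N (z v ∘ r), circleDiagonal_mem_archLocal_diagonal L N α v (z v ∘ r)⟩ : archLocal L N (diagonal α) v)), wt v σ =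
        Λ v * (((kottwitzSign (starRingEnd ℂ) (diagonal fun i => v.1.embedding (α i)) (diagonal fun i => ((z v ∘ r) i : ℂ)) : ℤˣ) : ℤ) : ℂ))
    (G : ConjClasses ↥(arch (↥(maximalRealSubfield L)) L (IsCMField.complexConj L) N (diagonal α)) → M) :
    ∑ ρ : {w : InfinitePlace L // IsComplex w} → Perm (Fin N), (∏ v, wt v (ρ v)) • G (ConjClasses.mk (archDiagTorus L N α fun w => z w ∘ ρ w)) =
      (∏ v, Λ v) • ∑ q ∈ univ.image (fun ρ : {w : InfinitePlace L // IsComplex w} → Perm (Fin N) => ConjClasses.mk (archDiagTorus L N α fun w => z w ∘ ρ w)),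
        kottwitzSignArchWeight L N (diagonal α) q • G q := by
  rw [sum_univ_prod_smul_mk_archDiagTorus_comp_eq_sum_image L N α z wt G, smul_sum]
  refine sum_congr rfl fun q hq => ?_
  obtain ⟨r, -, rfl⟩ := mem_image.1 hq
  rw [sum_filter_mk_archDiagTorus_comp_prod_eq_prod_sum_filter L N α z wt r, smul_smul, kottwitzSignArchWeight_mk_archDiagTorus, ← prod_mul_distrib]
  congr 1
  exact prod_congr rfl fun v _ => hΛ v (r v)

variable [∀ g : ↥(arch (↥(maximalRealSubfield L)) L (IsCMField.complexConj L) N (diagonal α)),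
    MeasurableSpace (↥(arch (↥(maximalRealSubfield L)) L (IsCMField.complexConj L) N (diagonal α)) ⧸
      Subgroup.centralizer ({g} : Set ↥(arch (↥(maximalRealSubfield L)) L (IsCMField.complexConj L) N (diagonal α))))]

open scoped Classical in
/-- **… AND WITH `G = Φ(·, a; m)` THE SUM IS `(∏_v Λ_v) · Φ^st_∞(t z, (e_∞∘⟦·⟧)·a)`** — the SIGNED archimedean stable orbital integral of the (ST-∞) conjunct at the torus point `t z`
(every family `m`, every `a`; ★ `archStableOrbitalIntegral_classWeight_mul_archDiagTorus_eq_sum_of_conj`; `α_i ≠ 0`, `c α_i = α_i`).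
[cite: Rogawski1990, §4.1 (4.1.2) pp. 39–40; §8.2 p. 124 («a non-zero constant times `Φ^st(γ₀, f)`»)] -/
theorem sum_univ_prod_mul_classOrbitalIntegral_mk_archDiagTorus_comp_eq_prod_mul_archStableOrbitalIntegral
    (hα : ∀ i, α i ≠ 0) (hherm : ∀ i, (IsCMField.complexConj L (α i) : L) = α i)
    (z : {w : InfinitePlace L // IsComplex w} → Fin N → Circle) (wt : {w : InfinitePlace L // IsComplex w} → Perm (Fin N) → ℂ)
    (Λ : {w : InfinitePlace L // IsComplex w} → ℂ)
    (hΛ : ∀ (v : {w : InfinitePlace L // IsComplex w}) (r : Perm (Fin N)),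
      ∑ σ ∈ univ.filter (fun σ : Perm (Fin N) =>
        ConjClasses.mk (⟨circleDiagonal N (z v ∘ σ), circleDiagonal_mem_archLocal_diagonal L N α v (z v ∘ σ)⟩ : archLocal L N (diagonal α) v) =
          ConjClasses.mk (⟨circleDiagonal N (z v ∘ r), circleDiagonal_mem_archLocal_diagonal L N α v (z v ∘ r)⟩ : archLocal L N (diagonal α) v)), wt v σ =
        Λ v * (((kottwitzSign (starRingEnd ℂ) (diagonal fun i => v.1.embedding (α i)) (diagonal fun i => ((z v ∘ r) i : ℂ)) : ℤˣ) : ℤ) : ℂ))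
    (m : OrbitalMeasureFamily ↥(arch (↥(maximalRealSubfield L)) L (IsCMField.complexConj L) N (diagonal α)))
    (a : ↥(arch (↥(maximalRealSubfield L)) L (IsCMField.complexConj L) N (diagonal α)) → ℂ) :
    ∑ ρ : {w : InfinitePlace L // IsComplex w} → Perm (Fin N), (∏ v, wt v (ρ v)) * classOrbitalIntegral m a (ConjClasses.mk (archDiagTorus L N α fun w => z w ∘ ρ w)) =
      (∏ v, Λ v) * archStableOrbitalIntegral L N (diagonal α) m (fun x => kottwitzSignArchWeight L N (diagonal α) (ConjClasses.mk x) * a x) (archDiagTorus L N α z) := by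
  have h := sum_univ_prod_smul_mk_archDiagTorus_comp_eq_prod_smul_sum_image_kottwitzSignArchWeight L N α z wt Λ hΛ (fun q => classOrbitalIntegral m a q)
  simp only [smul_eq_mul] at h
  rw [h, archStableOrbitalIntegral_classWeight_mul_archDiagTorus_eq_sum_of_conj L N α hα hherm z (kottwitzSignArchWeight L N (diagonal α)) m a]

end Torus

end Literature.NumberTheory.Rogawski1990

end
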